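import Summits.BirchSwinnertonDyer.BirchSwinnertonDyer.Theorems.AdditiveBranchIMCTwistConductorAnyTwo
import Literature.NumberTheory.EllipticCurves.CuspFormTwistAtkinLehnerTwoPrimesProofs
import HarnessLib

/-!
# `w(E^{(qℓ)}) = w(E)` at a non-split multiplicative Wan prime `q` — curves with odd additive primes of quadratic-twist type and
# ANY reduction at `2` (LEAD g14)

Theorems-side engine (theorems only; no definition, no named fact, no `sorry`), the third of the line: p744621 `TwistRootNumberOdd`
(LEAD g11: no additive reduction at `2, 3`, additive primes `≥ 5` of twist type), p754623 `TwistRootNumberOddThree` (LEAD g13: no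
additive reduction at `2`, every odd additive prime of twist type), and now NO HYPOTHESIS AT `2` AT ALL. The two earlier engines read
the Atkin–Lehner sign `λ₂` through the local root number, which the tree has only at a semistable `2`; here `λ₂(f_{E^{(qℓ)}}) = λ₂(f_E)`
comes from the modular side instead — the newform of `E^{(qℓ)}` is the double twist of that of `E` by `(·/q)(·/ℓ)`, the Atkin–Lehner
involution at the exact divisor `2^{f₂}` commutes with each twist up to `χ(2^{f₂})` (Shemanske–Walling 1993 Prop. 5.4 / Atkin–Li 1978
§1, the tree's `atkinLehnerInvolutionAt_charTwist_of_coprime_of_eq_smul`), and `(2/q)(2/ℓ) = χ₈(qℓ) = 1` for `qℓ ≡ 1 (mod 8)`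
(Literature `CuspFormTwistAtkinLehnerTwoPrimesProofs`, LEAD g14) —, while `f₂(E^{(qℓ)}) = f₂(E)` because the twist `qℓ ≡ 1 (mod 4)`
is unramified at `2` (`AdditiveBranchIMCTwistConductorAnyTwo`). Everything else is p754623 verbatim.

* `rootNumber_quadraticTwist_mul_eq_of_nonsplit_odd_anyTwo` — for `E / ℚ` (globally minimal `W`) whose ODD additive primes are of
  quadratic-twist type, `q` an odd prime of NON-SPLIT multiplicative reduction, `ℓ ≥ 5` a good prime with `qℓ ≡ 1 (mod 8)` and
  `(qℓ/p) = 1` at every odd `p ≠ q` of `N_E`: `w(E^{(qℓ)}) = w(E)`.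

Purpose: the twist-type sub-row of crux 19357 (`three_field_road`) no longer needs «no additive reduction above `2`» on the
root-number side (LeadReport21 §3.2(c)); the remaining uses of that clause are the semistable partner and the Castella–Liu–Wan reading.
BSD is proved for no curve by any of this.
References: [AtkinLi1978] §1, §3; [ShemanskeWalling1993] Prop. 5.4; [KellockDokchitser2023] Rem. 2.2, Thm. 2.3; [Knapp1993] Thm. 9.27.
-/

set_option linter.dupNamespace false
set_option autoImplicit false

noncomputable section

open scoped MatrixGroups Classical

open CongruenceSubgroup Literature.NumberTheory.EllipticCurves Literature.NumberTheory.EllipticCurves.ModularForms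
  IsDedekindDomain IsDedekindDomain.HeightOneSpectrum NumberField Rat.HeightOneSpectrum WeierstrassCurve
  Summit.BirchSwinnertonDyer.BirchSwinnertonDyer.Theorems

namespace Summit.BirchSwinnertonDyer.BirchSwinnertonDyer.Theorems.TwistRootNumberAnyTwo

variable (W : WeierstrassCurve ℚ) [W.IsElliptic] [W.IsGloballyMinimal]

/-- `natGenerator` of the place of `ℤ` under a prime `p` is `p` (the tree's `Rat.natGenerator_primesEquiv_symm`). [folklore] -/
private theorem natGenerator_symm' (p : Nat.Primes) : natGenerator ((primesEquiv (R := ℤ)).symm p) = p :=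
  Literature.NumberTheory.EllipticCurves.Rat.natGenerator_primesEquiv_symm p

/-- **The root number of a quadratic twist ramified at ONE non-split multiplicative prime — any odd prime `q`, `E` with odd
additive primes of quadratic-twist type and ANY reduction at `2`** (third engine of the line; p754623 assumed no additive `2`):
for `E / ℚ` (global minimal `W`, every ODD additive prime of quadratic-twist type), `q` an odd prime of NON-SPLIT multiplicative
reduction, `ℓ ≥ 5` an auxiliary good prime with `qℓ ≡ 1 (mod 8)` and `(qℓ / p) = 1` at every odd prime `p ≠ q` of `N_E`:
`w(E^{(qℓ)}) = w(E)`. MODULAR proof: `w = −ε(f)`, `ε(f) = ∏ λ_p(f)`, `N_{E^{(qℓ)}} = N_E q ℓ²`, Atkin–Li twisting at `q` and `ℓ`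
(`λ = (−1/q)`, `(−1/ℓ)`), `λ_q(f) = +1`, `λ_p(f') = λ_p(f)` elsewhere — at an ADDITIVE `2` by the double-twist law
`atkinLehnerEigenvalueAt_two_eq_of_quadraticTwist_mul` (`(2/q)(2/ℓ) = 1`) —, `(−1/q)(−1/ℓ) = 1`.
[cite: AtkinLi1978, §1 and §3] [cite: ShemanskeWalling1993, Prop. 5.4] [cite: KellockDokchitser2023, Rem. 2.2 and Thm. 2.3]
[cite: Knapp1993, Thm. 9.27] -/
theorem rootNumber_quadraticTwist_mul_eq_of_nonsplit_odd_anyTwo (hmod : exists_isNewformOf)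
    (htt : ∀ p : Nat.Primes, (p : ℕ) ≠ 2 → W.HasAdditiveReductionAt ((primesEquiv (R := ℤ)).symm p) →
      ¬ (W.quadraticTwist (((-1 : ℤ) ^ ((p : ℕ) / 2) * p : ℤ) : ℚ)).HasAdditiveReductionAt
        ((primesEquiv (R := ℤ)).symm p))
    {q ℓ : ℕ} [hq : Fact q.Prime] [hℓ : Fact ℓ.Prime] (hq2 : q ≠ 2) (hℓ5 : 5 ≤ ℓ) (hqℓ : q ≠ ℓ)
    (hqm : W.HasMultiplicativeReductionAtPrime q) (hqns : ¬ W.HasSplitMultiplicativeReductionAtPrime q)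
    (hℓg : W.HasGoodReductionAtPrime ℓ) (h8 : ((q : ℤ) * ℓ) % 8 = 1)
    (hjac : ∀ p : ℕ, p.Prime → p ∣ W.conductorNorm ℤ → p ≠ 2 → p ≠ q → jacobiSym ((q : ℤ) * ℓ) p = 1) :
    (W.quadraticTwist (((q : ℤ) * ℓ : ℤ) : ℚ)).rootNumber = W.rootNumber := by
  have hℓ2 : ℓ ≠ 2 := by omega
  set d : ℤ := (q : ℤ) * ℓ with hd
  have hd0 : d ≠ 0 := mul_ne_zero (by exact_mod_cast hq.out.ne_zero) (by exact_mod_cast hℓ.out.ne_zero)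
  have hdQ : (d : ℚ) ≠ 0 := by exact_mod_cast hd0
  set W' := W.quadraticTwist (d : ℚ) with hW'
  haveI : W'.IsElliptic := W.isElliptic_quadraticTwist hdQ
  set Pq : Nat.Primes := ⟨q, hq.out⟩
  set Pℓ : Nat.Primes := ⟨ℓ, hℓ.out⟩
  set vq : HeightOneSpectrum ℤ := (primesEquiv (R := ℤ)).symm Pq with hvq
  set vℓ : HeightOneSpectrum ℤ := (primesEquiv (R := ℤ)).symm Pℓ with hvℓ
  set N := W.conductorNorm ℤ with hN
  set N' := W'.conductorNorm ℤ with hN'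
  have hN0 : N ≠ 0 := (W.conductorNorm_pos_holds).ne'
  have hN'0 : N' ≠ 0 := (W'.conductorNorm_pos_holds).ne'
  haveI : NeZero (W.conductorNorm ℤ) := ⟨hN0⟩
  haveI : NeZero (W'.conductorNorm ℤ) := ⟨hN'0⟩
  -- `d` is a square at `2` and at the odd bad primes other than `q`
  have hsq : ∀ p : Nat.Primes, ((p : ℕ) = 2 ∨ ((p : ℕ) ∣ N ∧ (p : ℕ) ≠ q)) →
      haveI := Fact.mk p.2; IsSquare ((d : ℤ) : ℚ_[p]) := by
    intro p hp
    haveI := Fact.mk p.2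
    by_cases hp2 : (p : ℕ) = 2
    · exact isSquare_padic_of_emod_eight_eq_one hp2 (by rw [hd]; exact h8)
    · rcases hp with h | ⟨hN, hpq⟩
      · exact absurd h hp2
      · exact isSquare_padic_of_jacobiSym_eq_one hp2 (hjac p p.2 hN hp2 hpq)
  -- the conductor package (no hypothesis at `2`)
  have hred := fun (p : Nat.Primes) (hpq : p ≠ Pq) (hpℓ : p ≠ Pℓ) ↦ hasReductionAt_quadraticTwist_mul_iff W h8 p hpq hpℓ
  have hfeq := fun (p : Nat.Primes) (hpq : p ≠ Pq) (hpℓ : p ≠ Pℓ) ↦ conductorExponent_quadraticTwist_mul_eq W htt h8 p hpq hpℓ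
  have hN'eq : N' = N * q * ℓ ^ 2 := conductorNorm_quadraticTwist_mul_eq W htt hq2 hℓ5 hqℓ hqm hℓg h8
  have hle := conductorExponent_pStar_le W htt
  have hle' := conductorExponent_pStar_quadraticTwist_le W htt hq2 hℓ5 hqℓ hqm h8
  have hfq' : W'.conductorExponent vq = 2 :=
    TwistRootNumberOdd.conductorExponent_quadraticTwist_eq_two_of_hasMultiplicativeReductionAtPrime W hq2 hqm hd0
      (by rw [hd]; exact dvd_mul_right _ _) (by rw [hd]; exact not_sq_dvd_mul hqℓ)
  have hfq : W.conductorExponent vq = 1 :=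
    (conductorExponent_eq_one_iff_holds vq W).mpr ((W.hasMultiplicativeReductionAtPrime_iff_hasMultiplicativeReductionAt_holds Pq).mp hqm)
  have haddℓ' : W'.HasAdditiveReductionAt vℓ := W.hasAdditiveReductionAt_quadraticTwist_mul_of_hasGoodReductionAtPrime hℓ2 hqℓ hℓg
  have hfℓ' : W'.conductorExponent vℓ = 2 :=
    Literature.NumberTheory.EllipticCurves.conductorExponent_eq_two_of_five_le_holds W' vℓ (by rw [hvℓ, natGenerator_symm']; exact hℓ5) haddℓ'
  have hfℓ : W.conductorExponent vℓ = 0 :=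
    (conductorExponent_eq_zero_iff_holds vℓ W).mpr ((W.hasGoodReductionAtPrime_iff_hasGoodReductionAt_holds Pℓ).mp hℓg)
  have hdvd_iff : ∀ (n : ℕ) (hn : n ≠ 0) (p : Nat.Primes), (p : ℕ) ∣ n ↔ n.factorization p ≠ 0 := by
    intro n hn p
    rw [Ne, Nat.factorization_eq_zero_iff]
    push Not
    exact ⟨fun h ↦ ⟨p.2, h, hn⟩, fun h ↦ h.2.1⟩
  have hqN : (q : ℕ) ∣ N := (hdvd_iff N hN0 Pq).mpr (by rw [factorization_conductorNorm_primesEquiv_symm W Pq, hfq]; norm_num)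
  have hqqN : ¬ (q : ℕ) ^ 2 ∣ N := by
    rw [hq.out.pow_dvd_iff_le_factorization hN0, show N.factorization q = N.factorization Pq from rfl,
      factorization_conductorNorm_primesEquiv_symm W Pq, hfq]
    omega
  have hℓN : ¬ (ℓ : ℕ) ∣ N := fun h ↦ (hdvd_iff N hN0 Pℓ).mp h (by rw [factorization_conductorNorm_primesEquiv_symm W Pℓ, hfℓ])
  have hqmem : q ∈ N.primeFactors := Nat.mem_primeFactors.mpr ⟨hq.out, hqN, hN0⟩
  have hℓmem : ℓ ∉ N.primeFactors := fun h ↦ hℓN (Nat.mem_primeFactors.mp h).2.1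
  have hpf : N'.primeFactors = insert ℓ N.primeFactors := by
    rw [hN'eq, Nat.primeFactors_mul (mul_ne_zero hN0 hq.out.ne_zero) (pow_ne_zero _ hℓ.out.ne_zero),
      Nat.primeFactors_mul hN0 hq.out.ne_zero, Nat.primeFactors_pow _ two_ne_zero, hq.out.primeFactors, hℓ.out.primeFactors,
      Finset.union_eq_left.mpr (Finset.singleton_subset_iff.mpr hqmem), Finset.union_comm, ← Finset.insert_eq]
  -- newforms
  obtain ⟨f, hf⟩ := hmod W
  obtain ⟨f', hf'⟩ := hmod W'
  have hε := IsNewform0.frickeEigenvalue_eq_prod_atkinLehnerEigenvalueAt_holds hf.1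
  have hε' := IsNewform0.frickeEigenvalue_eq_prod_atkinLehnerEigenvalueAt_holds hf'.1
  -- `λ_q(f') = χ₄ q`, `λ_ℓ(f') = χ₄ ℓ`
  have haddq' : W'.HasAdditiveReductionAt vq := (two_le_conductorExponent_iff_holds vq W').mp (by rw [hfq'])
  have hlamq_tw : atkinLehnerEigenvalueAt f' q = (ZMod.χ₄ q : ℂ) :=
    W'.atkinLehnerEigenvalueAt_eq_χ₄_of_twist_of_le hmod hf' Pq hq2 haddq'
      (W.not_hasAdditiveReductionAt_quadraticTwist_mul_pStar_left hq2 hqℓ hqm) hfq' (hle' Pq hq2)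
  have hlaml_tw : atkinLehnerEigenvalueAt f' ℓ = (ZMod.χ₄ ℓ : ℂ) :=
    W'.atkinLehnerEigenvalueAt_eq_χ₄_of_twist_of_le hmod hf' Pℓ hℓ2 haddℓ'
      (W.not_hasAdditiveReductionAt_quadraticTwist_mul_pStar_right hℓ2 hqℓ hℓg) hfℓ' (hle' Pℓ hℓ2)
  -- `λ_q(f) = 1`
  have hlamq : atkinLehnerEigenvalueAt f q = 1 := by
    have h := W.atkinLehnerEigenvalueAt_eq_localRootNumberAt_of_not_sq_dvd hf Pq hqN hqqN
    rw [h, localRootNumberAt_primesEquiv_symm_eq, localRootNumber_of_hasMultiplicativeReduction _ _ hqm hqns]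
    simp
  -- `λ_r(f') = λ_r(f)` at the other primes of `N`
  have hlam_eq : ∀ r ∈ N.primeFactors.erase q, atkinLehnerEigenvalueAt f' r = atkinLehnerEigenvalueAt f r := by
    intro r hr
    obtain ⟨hrq, hrN⟩ := Finset.mem_erase.mp hr
    obtain ⟨hrp, hrdvd, -⟩ := Nat.mem_primeFactors.mp hrN
    have hrℓ : r ≠ ℓ := fun h ↦ hℓN (h ▸ hrdvd)
    set R : Nat.Primes := ⟨r, hrp⟩
    have hRq : R ≠ Pq := fun h ↦ hrq (congrArg Subtype.val h)
    have hRℓ : R ≠ Pℓ := fun h ↦ hrℓ (congrArg Subtype.val h)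
    haveI := Fact.mk hrp
    have hbad : ¬ W.HasGoodReductionAt ((primesEquiv (R := ℤ)).symm R) := fun hg ↦
      ((W.dvd_conductorNorm_iff_not_hasGoodReductionAtPrime r).mp hrdvd)
        ((W.hasGoodReductionAtPrime_iff_hasGoodReductionAt_holds R).mpr hg)
    rcases hasGoodReductionAt_or_hasMultiplicativeReductionAt_or_hasAdditiveReductionAt
      ((primesEquiv (R := ℤ)).symm R) W with h | hm | ha
    · exact absurd h hbad
    · -- multiplicative: both are the local root number, and `W' ≅ W` over `ℚ_r`
      have hf1 : W.conductorExponent ((primesEquiv (R := ℤ)).symm R) = 1 := (conductorExponent_eq_one_iff_holds _ W).mpr hm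
      have hf1' : W'.conductorExponent ((primesEquiv (R := ℤ)).symm R) = 1 := by rw [hfeq R hRq hRℓ, hf1]
      have hrN' : r ∣ N' := (hdvd_iff N' hN'0 R).mpr (by rw [factorization_conductorNorm_primesEquiv_symm W' R, hf1']; norm_num)
      have hrrN' : ¬ r ^ 2 ∣ N' := by
        rw [hrp.pow_dvd_iff_le_factorization hN'0, show N'.factorization r = N'.factorization R from rfl,
          factorization_conductorNorm_primesEquiv_symm W' R, hf1']
        omega
      have hrrN : ¬ r ^ 2 ∣ N := by
        rw [hrp.pow_dvd_iff_le_factorization hN0, show N.factorization r = N.factorization R from rfl,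
          factorization_conductorNorm_primesEquiv_symm W R, hf1]
        omega
      rw [W'.atkinLehnerEigenvalueAt_eq_localRootNumberAt_of_not_sq_dvd hf' R hrN' hrrN',
        W.atkinLehnerEigenvalueAt_eq_localRootNumberAt_of_not_sq_dvd hf R hrdvd hrrN,
        W.localRootNumberAt_quadraticTwist_of_isSquare R hd0 (hsq R (by
          by_cases h2 : r = 2
          · exact Or.inl h2
          · exact Or.inr ⟨hrdvd, hrq⟩))]
    · by_cases hr2 : r = 2
      · -- ADDITIVE AT `2` (new): the double-twist law on the modular side, `(2/q)(2/ℓ) = 1`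
        subst hr2
        set wq : HeightOneSpectrum (𝓞 ℚ) := (primesEquiv (R := 𝓞 ℚ)).symm Pq with hwq
        set wℓ : HeightOneSpectrum (𝓞 ℚ) := (primesEquiv (R := 𝓞 ℚ)).symm Pℓ with hwℓ
        have hwqv : (primesEquiv wq : ℕ) = q := by rw [hwq, Equiv.apply_symm_apply]
        have hwℓv : (primesEquiv wℓ : ℕ) = ℓ := by rw [hwℓ, Equiv.apply_symm_apply]
        have haddqO : W'.HasAdditiveReductionAt wq := (W'.hasAdditiveReductionAt_int_iff_ringOfIntegers Pq).mp haddq'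
        have haddℓO : W'.HasAdditiveReductionAt wℓ := (W'.hasAdditiveReductionAt_int_iff_ringOfIntegers Pℓ).mp haddℓ'
        exact W.atkinLehnerEigenvalueAt_two_eq_of_quadraticTwist_mul hq2 hℓ2 h8 hwqv hwℓv haddqO haddℓO hf hf' hN'eq hrdvd hqN
      · -- additive (odd, twist type): both are `χ₄ r`
        have hps0 : (((-1 : ℤ) ^ (r / 2) * r : ℤ) : ℚ) ≠ 0 := by
          have : (-1 : ℤ) ^ (r / 2) * r ≠ 0 := mul_ne_zero (pow_ne_zero _ (by norm_num)) (by exact_mod_cast hrp.ne_zero)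
          exact_mod_cast this
        haveI := W.isElliptic_quadraticTwist hps0
        have hsemi := htt R hr2 ha
        have ha' : W'.HasAdditiveReductionAt ((primesEquiv (R := ℤ)).symm R) := (hred R hRq hRℓ).2.2.mpr ha
        have hsemi' : ¬ (W'.quadraticTwist (((-1 : ℤ) ^ ((R : ℕ) / 2) * R : ℤ) : ℚ)).HasAdditiveReductionAt
            ((primesEquiv (R := ℤ)).symm R) := by
          rw [hW', hd]; exact twistType_quadraticTwist_of_not_dvd W htt _ R hr2 (not_natGenerator_dvd_mul R hRq hRℓ) ha
        rw [W'.atkinLehnerEigenvalueAt_eq_χ₄_of_twist_of_le hmod hf' R hr2 ha' hsemi'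
            (TwistTypeConductor.conductorExponent_eq_two_of_twistType_odd W' R hr2 ha' (fun _ ↦ hsemi')) (hle' R hr2),
          W.atkinLehnerEigenvalueAt_eq_χ₄_of_twist_of_le hmod hf R hr2 ha hsemi
            (TwistTypeConductor.conductorExponent_eq_two_of_twistType_odd W R hr2 ha (fun _ ↦ hsemi)) (hle R hr2)]
  -- the products
  have hP : ∏ r ∈ N.primeFactors.erase q, atkinLehnerEigenvalueAt f' r =
      ∏ r ∈ N.primeFactors.erase q, atkinLehnerEigenvalueAt f r := Finset.prod_congr rfl hlam_eq
  have hχ : (ZMod.χ₄ ℓ : ℂ) * (ZMod.χ₄ q : ℂ) = 1 := by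
    have h4 : ((ℓ : ZMod 4) * (q : ZMod 4)) = 1 := by
      have hmod : ((ℓ * q : ℕ) : ℤ) % 4 = 1 := by push_cast; rw [mul_comm]; omega
      have hmod' : (ℓ * q) % 4 = 1 := by exact_mod_cast hmod
      rw [← Nat.cast_mul, ← ZMod.natCast_mod, hmod', Nat.cast_one]
    have h : ZMod.χ₄ ℓ * ZMod.χ₄ q = 1 := by rw [← map_mul, h4, map_one]
    exact_mod_cast congrArg (fun z : ℤ ↦ (z : ℂ)) h
  have hεeq : frickeEigenvalue f' = frickeEigenvalue f := by
    rw [hε', hε, hpf, Finset.prod_insert hℓmem, ← Finset.mul_prod_erase _ _ hqmem,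
      ← Finset.mul_prod_erase N.primeFactors _ hqmem, hlaml_tw, hlamq_tw, hlamq, hP, ← mul_assoc, hχ]
  have hw' := rootNumber_eq_neg_frickeEigenvalue (W := W') (fun _ _ ↦ IsNewform0.exists_functional_equation_holds)
    (fun _ _ ↦ IsNewform0.frickeEigenvalue_eq_one_or_eq_neg_one_holds) hf'
  have hw := rootNumber_eq_neg_frickeEigenvalue (W := W) (fun _ _ ↦ IsNewform0.exists_functional_equation_holds)
    (fun _ _ ↦ IsNewform0.frickeEigenvalue_eq_one_or_eq_neg_one_holds) hf
  have h : ((W'.rootNumber : ℤ) : ℂ) = ((W.rootNumber : ℤ) : ℂ) := by rw [hw', hw, hεeq]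
  exact_mod_cast h

end Summit.BirchSwinnertonDyer.BirchSwinnertonDyer.Theorems.TwistRootNumberAnyTwo

end
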